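import Literature.MathematicalPhysics.QuantumFieldTheory.Balaban1983to89.B6SectCTwoScaleV1Lattice

/-!
# `Balaban1983to89.B6QppKernelV1` — T. Bałaban, *Propagators and renormalization transformations for lattice gauge
# theories. II*, Commun. Math. Phys. **96** (1984) 223–250 [Balaban1984PropagatorsII], (2.119)–(2.120) pp. 243–244 with p. 246: THE KERNEL OF
# `Q″*aQ″` IN THE BOND BASIS OF THE UNIT TORUS — the finite-range part of the operator of the `B`-Gaussian (2.119) for the concrete two-scale
# data `tsV1`: `⟨e_b, Q″*aQ″e_{b′}⟩ = Σ_i w_i q_i(b)q_i(b′)` with `q_i(b) = (Q″e_b)_i ≥ 0`, BLOCK-LOCAL, of column mass `1` and row mass `≤ 2`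

statement-level skeleton of published theorems with citation tags; proofs where landed; nothing here is a claim about the Yang–Mills mass gap

PDF held: `paper:balaban1984-cmp96-propagators-rt-ii` (journal page = PDF page + 222; pp. 243–246 [PDF 21–24]; p. 246 read AS IMAGE on the ×2
render `run/shared/lean/pub/pub-balaban/b2b-balaban-ref1/pages/1984-cmp96-propagators-rt-II/…-p024-x2.png`, 2026-08-22).

PRINT (verbatim).  p. 244: *"… exp[−½⟨B, (Q″*aQ″ + Δ_j)B⟩ + …] (2.119) … (we take a = 1) ‖B↾_{Λ^c}‖² + L^{−2}‖(Q₁B)↾_{Λ′}‖² + ⟨B, Δ_jB⟩ (2.120)"*;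
p. 246: *"This implies that a covariance C̃^{(j)}_Λ of the Gaussian integral in (2.119) … has an exponential decay with a decay rate having the same
property."*  [Balaban1984PropagatorsI] (1.11) p. 19: *"(QA)(c) = Σ_{x∈B(c₋)} L^{−(d+1)} A([x, x(c)])"*.

CITATION HEADER (lean-in-tree rule) — WHAT IS REPRODUCED.  Phase-2 file of the `lit-balaban` typed skeleton (HOME
`run/shared/lean/pub/lit-balaban/`), seat **p22 gen 12** (B6 fold owner r03, referee ref-4; lane = the Sect. C chain (2.95)–(2.147) on the
concrete two-scale data `tsV1`).  SKELETON row **B6.Txt@246** (the «exponential decay» clause of the C̃-sentence) — INPUT: the `Q″*aQ″` part of the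
kernel of `Q″*aQ″ + Δ_j` (the `Δ_j` part is `…B6DeltaJKernelTwoScaleV1.kernel_Δj_decay`).  IMPORTS BY NAME: gen 7/8's `…B6SectCTwoScaleV1.Qpp/aW/
Qpp_inl/Qpp_inr/aW_apply` (`Q″B = (B↾Λ^c, (Q₁B)↾Λ′)`), `…B6SectCTwoScaleV1Lattice.tsV1`, `LatticeFieldCalculus.bondAvg/segSum/runBond/bondEquiv/
shiftEquiv/runSite_succ`, p16's `…B5AveragingLocalityV1.bondAvg_eq_zero_of_local` (block locality of `Q`), `TorusGeometry.Site.blockEquiv`.  THIS FILE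
(`q_i(b) := (Q″e_b)_i`, `e_b` the basis field of the bond `b` of `T^{(j)}`, `i ∈ 𝔅 = Λ^c ⊔ Λ′`):
* §1 `qpp_single_inl`/`qpp_single_inr` (values), **`qpp_single_nonneg`**, **`qpp_single_inr_ne_zero`** (block locality: `(Q₁e_b)(c) ≠ 0 ⇒ y(b₋) ∈ {c₋, c₊}`),
  `qpp_single_inl_ne_zero` (`(e_b)(o) ≠ 0 ⇒ b = o`);
* §2 **`sum_qpp_single_col`** (COLUMN MASS: `Σ_{b′} q_i(b′) = 1` for every `i` — `Q″𝟙 = 𝟙`; the identity `Q₁𝟙 = 𝟙` is p09's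
  `BIJ88ClocFactorsTorus.bondAvg_const_one`, re-derived inline to keep the import cone inside B6);
* §3 **`sum_bondAvg_single`** (`Σ_{c∈T^{(j+1)}} (Q₁e_b)(c) = L^{−d}`: block and translation re-indexing), **`sum_qpp_single_row_le`** (ROW MASS: `Σ_i q_i(b) ≤ 2`);
* §4 **`inner_single_QaQ_single`** (`⟨e_b, Q″*aQ″e_{b′}⟩ = Σ_i w_i q_i(b)q_i(b′)`) and, for `tsV1`, **`inner_single_Sb_single`**:
  `⟨e_b, (Q″*aQ″ + Δ_j)e_{b′}⟩ = Σ_i w_i q_i(b)q_i(b′) + ⟨e_b, Δ_je_{b′}⟩`.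
THEOREMS ONLY (no definition, no `def … : Prop` fact); standard axioms.  HONEST SCOPE: elementary bookkeeping about the averaging operator of the V1
calculus (centred blocks, `L` odd, standing range `j + 1 ≤ m + K`); crude masses (`≤ 2`); NOT summit progress.
-/

noncomputable section

open scoped InnerProductSpace
open Finset

namespace Literature.MathematicalPhysics.QuantumFieldTheory.Balaban1983to89.B6QppKernelV1

open LatticeFieldCalculus B6SectAOperatorsV1 B6SectCTwoScaleV1 B6SectCTwoScaleV1Lattice
open B6SectCOperators (TwoScaleData)
open B5AveragingLocalityV1 (bondAvg_eq_zero_of_local)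

variable {P : Params} {j : ℕ} (Λ' : Finset (Site P (j + 1))) [DecidableEq (PBond P j)]

/-! ## §1  The entries `q_i(b) = (Q″e_b)_i`: values, sign, block locality -/

/-- `q_{Λ^c-bond o}(b) = [b = o]`. [cite: Balaban1984PropagatorsII, (2.119) p.243] -/
theorem qpp_single_inl (b : PBond P j) (o : OutBond j Λ') :
    Qpp P j Λ' (EuclideanSpace.single b (1 : ℝ)) (Sum.inl o) = if o.1 = b then 1 else 0 := by
  rw [Qpp_inl, PiLp.single_apply]

/-- `q_{Λ′-bond c}(b) = (Q₁e_b)(c)`. [cite: Balaban1984PropagatorsII, (2.119) p.243] -/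
theorem qpp_single_inr (b : PBond P j) (e : InBond j Λ') :
    Qpp P j Λ' (EuclideanSpace.single b (1 : ℝ)) (Sum.inr e) = bondAvg (Pi.single b (1 : ℝ)) e.1 := by
  rw [Qpp_inr, PiLp.ofLp_single]

omit [DecidableEq (PBond P j)] in
/-- the bond average of a pointwise non-negative field is non-negative. [cite: Balaban1984PropagatorsI, (1.11) p.19] -/
theorem bondAvg_nonneg {X : VecField P j ℝ} (hX : ∀ b, 0 ≤ X b) (c : PBond P (j + 1)) : 0 ≤ bondAvg X c := by
  unfold bondAvg
  rw [smul_eq_mul]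
  refine mul_nonneg (inv_nonneg.2 (by positivity)) (Finset.sum_nonneg fun r _ => ?_)
  unfold segSum
  exact Finset.sum_nonneg fun t _ => hX _

/-- **`q_i(b) ≥ 0`**. [cite: Balaban1984PropagatorsII, (2.119) p.243] -/
theorem qpp_single_nonneg (b : PBond P j) (i : CIdx j Λ') : 0 ≤ Qpp P j Λ' (EuclideanSpace.single b (1 : ℝ)) i := by
  rcases i with o | e
  · rw [qpp_single_inl]
    split_ifs <;> norm_num
  · rw [qpp_single_inr]
    refine bondAvg_nonneg (fun b' => ?_) _
    by_cases h : b' = b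
    · rw [h, Pi.single_eq_same]; norm_num
    · rw [Pi.single_eq_of_ne h]

/-- `q_{Λ^c-bond o}(b) ≠ 0 ⇒ b = o`. [cite: Balaban1984PropagatorsII, (2.119) p.243] -/
theorem qpp_single_inl_ne_zero {b : PBond P j} {o : OutBond j Λ'} (h : Qpp P j Λ' (EuclideanSpace.single b (1 : ℝ)) (Sum.inl o) ≠ 0) :
    b = o.1 := by
  rw [qpp_single_inl] at h
  by_contra hb
  exact h (if_neg (Ne.symm hb))

/-- **BLOCK LOCALITY**: `(Q₁e_b)(c) ≠ 0 ⇒` the block of the source of `b` is `c₋` or `c₊` (p16's `bondAvg_eq_zero_of_local`).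
[cite: Balaban1984PropagatorsI, (1.11) p.19] -/
theorem qpp_single_inr_ne_zero (hj : j + 1 ≤ P.m + P.K) {b : PBond P j} {e : InBond j Λ'}
    (h : Qpp P j Λ' (EuclideanSpace.single b (1 : ℝ)) (Sum.inr e) ≠ 0) : blockOf b.src = e.1.src ∨ blockOf b.src = e.1.tgt := by
  rw [qpp_single_inr] at h
  by_contra hb
  refine h (bondAvg_eq_zero_of_local hj _ e.1 fun b' hsrc _ => ?_)
  by_cases hb' : b' = b
  · subst hb'
    exact absurd hsrc hb
  · exact Pi.single_eq_of_ne hb' _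

/-! ## §2  Column mass: `Σ_{b′} q_i(b′) = 1` -/

/-- **COLUMN MASS**: `Σ_{b′∈T^{(j)}} q_i(b′) = 1` for every `i ∈ 𝔅` (linearity: `Σ_{b′}e_{b′} = 𝟙` and `Q″𝟙 = 𝟙`).
[cite: Balaban1984PropagatorsII, (2.119) p.243] -/
theorem sum_qpp_single_col (i : CIdx j Λ') : ∑ b' : PBond P j, Qpp P j Λ' (EuclideanSpace.single b' (1 : ℝ)) i = 1 := by
  have hsum : ∑ b' : PBond P j, (EuclideanSpace.single b' (1 : ℝ) : UBond P j) = WithLp.toLp 2 (fun _ => (1 : ℝ)) := by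
    apply PiLp.ext
    intro b
    rw [WithLp.ofLp_sum, Finset.sum_apply, PiLp.toLp_apply]
    simp only [PiLp.ofLp_single]
    rw [Finset.sum_eq_single b (fun b' _ hb' => Pi.single_eq_of_ne' hb' _) (fun h => absurd (Finset.mem_univ b) h), Pi.single_eq_same]
  rw [← Finset.sum_apply, ← WithLp.ofLp_sum, ← map_sum, hsum]
  rcases i with o | e
  · rw [Qpp_inl, PiLp.toLp_apply]
  · rw [Qpp_inr, WithLp.ofLp_toLp]
    -- `Q₁𝟙 = 𝟙`: `L^{−(d+1)}·L^d·L = 1` (the statement of p09's `BIJ88ClocFactorsTorus.bondAvg_const_one`, re-derived inline to keep the B6 import cone)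
    unfold bondAvg segSum
    simp only [Finset.sum_const, Finset.card_range, Finset.card_univ, Fintype.card_fun, Fintype.card_fin, nsmul_eq_mul, mul_one,
      smul_eq_mul]
    have hL : (P.L : ℝ) ≠ 0 := ne_of_gt P.cast_L_pos
    push_cast
    rw [pow_succ]
    field_simp

/-! ## §3  Row mass: `Σ_i q_i(b) ≤ 2` -/

omit [DecidableEq (PBond P j)] in
/-- a sum over bonds is a double sum over sites and directions. [folklore] -/
private theorem sum_bond_eq {k : ℕ} {α : Type*} [AddCommMonoid α] (F : PBond P k → α) :
    ∑ b : PBond P k, F b = ∑ x : Site P k, ∑ μ : Fin P.d, F ⟨x, μ⟩ :=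
  calc ∑ b : PBond P k, F b = ∑ p : Site P k × Fin P.d, F (bondEquiv p) := (Equiv.sum_comp (bondEquiv (P := P) (j := k)) F).symm
    _ = ∑ x : Site P k, ∑ μ : Fin P.d, F ⟨x, μ⟩ := Fintype.sum_prod_type _

omit [DecidableEq (PBond P j)] in
/-- a sum over the fine torus is the sum over blocks of the sums over block offsets (standing range). [folklore] -/
private theorem sum_blockSite {α : Type*} [AddCommMonoid α] (hj : j + 1 ≤ P.m + P.K) (F : Site P j → α) :
    ∑ x, F x = ∑ y : Site P (j + 1), ∑ r : Fin P.d → Fin P.L, F (Site.blockSite y r) := by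
  rw [← Finset.sum_fiberwise_of_maps_to (s := Finset.univ) (t := Finset.univ) (g := blockOf) (fun _ _ => Finset.mem_univ _) F]
  refine Finset.sum_congr rfl fun y _ => ?_
  have hmem : ∀ x : Site P j, blockOf x = y ↔ x ∈ ({x ∈ Finset.univ | blockOf x = y} : Finset (Site P j)) := fun x => by simp
  let e : (Fin P.d → Fin P.L) ≃ ↥({x ∈ Finset.univ | blockOf x = y} : Finset (Site P j)) :=
    (Site.blockEquiv hj y).symm.trans (Equiv.subtypeEquivRight hmem)
  rw [← Finset.sum_coe_sort _ F, ← Equiv.sum_comp e (fun a => F a.1)]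
  exact Finset.sum_congr rfl fun r _ => rfl

omit [DecidableEq (PBond P j)] in
/-- translation invariance of the sum over the torus: `Σ_x F(x + te_μ) = Σ_x F(x)`. [folklore] -/
private theorem sum_runSite {α : Type*} [AddCommMonoid α] (μ : Fin P.d) (t : ℕ) : ∀ F : Site P j → α,
    ∑ x, F (runSite x μ t) = ∑ x, F x := by
  induction t with
  | zero => intro F; simp only [runSite_zero]
  | succ t ih =>
    intro F
    simp only [runSite_succ]
    rw [ih (fun x => F (x.shift μ))]
    exact Equiv.sum_comp (shiftEquiv (P := P) (j := j) μ) F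

omit [DecidableEq (PBond P j)] in
/-- **`Σ_{c∈T^{(j+1)}} (Q₁X)(c) = L^{−d}·Σ_b X(b)`**: every fine bond is the `t`-th bond of exactly `L` straight contours `[x, x(c)]` (block and translation
re-indexing). [cite: Balaban1984PropagatorsI, (1.11) p.19] -/
theorem sum_bondAvg (hj : j + 1 ≤ P.m + P.K) (X : VecField P j ℝ) :
    ∑ c : PBond P (j + 1), bondAvg X c = ((P.L : ℝ) ^ P.d)⁻¹ * ∑ b : PBond P j, X b := by
  have hL : (P.L : ℝ) ≠ 0 := ne_of_gt P.cast_L_pos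
  -- the inner re-indexing, direction by direction
  have h1 : ∀ μ : Fin P.d, ∑ y : Site P (j + 1), ∑ r : Fin P.d → Fin P.L, segSum X (Site.blockSite y r) μ P.L =
      (P.L : ℝ) * ∑ x : Site P j, X ⟨x, μ⟩ := by
    intro μ
    rw [← sum_blockSite hj (fun x => segSum X x μ P.L)]
    unfold segSum runBond
    rw [Finset.sum_comm, Finset.sum_congr rfl fun t _ => sum_runSite μ t (fun x => X ⟨x, μ⟩), Finset.sum_const, Finset.card_range,
      nsmul_eq_mul]
  have h2 : ∑ c : PBond P (j + 1), bondAvg X c =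
      ((P.L : ℝ) ^ (P.d + 1))⁻¹ * ∑ μ : Fin P.d, ∑ y : Site P (j + 1), ∑ r : Fin P.d → Fin P.L, segSum X (Site.blockSite y r) μ P.L := by
    unfold bondAvg
    simp only [smul_eq_mul]
    rw [← Finset.mul_sum, sum_bond_eq, Finset.sum_comm]
  rw [h2, Finset.sum_congr rfl fun μ _ => h1 μ, ← Finset.mul_sum, sum_bond_eq (k := j), Finset.sum_comm, pow_succ]
  field_simp

/-- **`Σ_{c∈T^{(j+1)}} (Q₁e_b)(c) = L^{−d}`**. [cite: Balaban1984PropagatorsI, (1.11) p.19] -/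
theorem sum_bondAvg_single (hj : j + 1 ≤ P.m + P.K) (b : PBond P j) :
    ∑ c : PBond P (j + 1), bondAvg (Pi.single b (1 : ℝ)) c = ((P.L : ℝ) ^ P.d)⁻¹ := by
  rw [sum_bondAvg hj, Finset.sum_eq_single b (fun b' _ hb' => Pi.single_eq_of_ne hb' _) (fun h => absurd (Finset.mem_univ b) h),
    Pi.single_eq_same, mul_one]

/-- **ROW MASS**: `Σ_{i∈𝔅} q_i(b) ≤ 2` (`≤ 1` from the `Λ^c`-bonds, `≤ L^{−d} ≤ 1` from the `Λ′`-bonds). [cite: Balaban1984PropagatorsII, (2.119) p.243] -/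
theorem sum_qpp_single_row_le (hj : j + 1 ≤ P.m + P.K) (b : PBond P j) :
    ∑ i : CIdx j Λ', Qpp P j Λ' (EuclideanSpace.single b (1 : ℝ)) i ≤ 2 := by
  rw [Fintype.sum_sum_type]
  have h1 : ∑ o : OutBond j Λ', Qpp P j Λ' (EuclideanSpace.single b (1 : ℝ)) (Sum.inl o) ≤ 1 := by
    simp only [qpp_single_inl]
    by_cases hb : blockOf b.src ∉ Λ' ∧ blockOf b.tgt ∉ Λ'
    · rw [Finset.sum_eq_single (⟨b, hb⟩ : OutBond j Λ')]
      · simp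
      · intro o _ ho
        rw [if_neg]
        intro h
        exact ho (Subtype.ext h)
      · intro h
        exact absurd (Finset.mem_univ _) h
    · rw [Finset.sum_eq_zero]
      · norm_num
      · intro o _
        rw [if_neg]
        intro h
        exact hb (h ▸ o.2)
  have h2 : ∑ e : InBond j Λ', Qpp P j Λ' (EuclideanSpace.single b (1 : ℝ)) (Sum.inr e) ≤ 1 := by
    simp only [qpp_single_inr]
    have hnn : ∀ c : PBond P (j + 1), 0 ≤ bondAvg (Pi.single b (1 : ℝ)) c := fun c =>
      bondAvg_nonneg (fun b' => by
        by_cases h : b' = b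
        · rw [h, Pi.single_eq_same]; norm_num
        · rw [Pi.single_eq_of_ne h]) c
    calc ∑ e : InBond j Λ', bondAvg (Pi.single b (1 : ℝ)) e.1
        = ∑ c ∈ Finset.univ.filter (fun c : PBond P (j + 1) => c.src ∈ Λ' ∨ c.tgt ∈ Λ'), bondAvg (Pi.single b (1 : ℝ)) c := by
          rw [Finset.sum_subtype (Finset.univ.filter (fun c : PBond P (j + 1) => c.src ∈ Λ' ∨ c.tgt ∈ Λ'))
            (p := fun c : PBond P (j + 1) => c.src ∈ Λ' ∨ c.tgt ∈ Λ') (fun c => by simp)]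
      _ ≤ ∑ c : PBond P (j + 1), bondAvg (Pi.single b (1 : ℝ)) c :=
          Finset.sum_le_sum_of_subset_of_nonneg (Finset.filter_subset _ _) fun c _ _ => hnn c
      _ = ((P.L : ℝ) ^ P.d)⁻¹ := sum_bondAvg_single hj b
      _ ≤ 1 := inv_le_one_of_one_le₀ (one_le_pow₀ (by exact_mod_cast P.L_pos))
  linarith

/-! ## §4  The bilinear form of `Q″*aQ″` and of `Q″*aQ″ + Δ_j` in the bond basis -/

/-- **`⟨e_b, Q″*aQ″e_{b′}⟩ = Σ_{i∈𝔅} w_i q_i(b)q_i(b′)`**. [cite: Balaban1984PropagatorsII, (2.119) p.243] -/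
theorem inner_single_QaQ_single (w : CIdx j Λ' → ℝ) (b b' : PBond P j) :
    ⟪EuclideanSpace.single b (1 : ℝ),
        (LinearMap.adjoint (Qpp P j Λ') ∘ₗ aW P j Λ' w ∘ₗ Qpp P j Λ') (EuclideanSpace.single b' (1 : ℝ))⟫_ℝ =
      ∑ i : CIdx j Λ', w i * (Qpp P j Λ' (EuclideanSpace.single b (1 : ℝ)) i * Qpp P j Λ' (EuclideanSpace.single b' (1 : ℝ)) i) := by
  simp only [LinearMap.coe_comp, Function.comp_apply]
  rw [LinearMap.adjoint_inner_right, inner_eq_sum]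
  refine Finset.sum_congr rfl fun i _ => ?_
  rw [aW_apply]
  ring

variable {c : ℝ} (hc : c ≠ 0) (w : CIdx j Λ' → ℝ)

/-- **THE KERNEL OF THE OPERATOR OF THE `B`-GAUSSIAN (2.119) for `tsV1`**: `⟨e_b, (Q″*aQ″ + Δ_j)e_{b′}⟩ = Σ_i w_i q_i(b)q_i(b′) + ⟨e_b, Δ_je_{b′}⟩`.
[cite: Balaban1984PropagatorsII, (2.119)–(2.120) pp.243–244] -/
theorem inner_single_Sb_single (b b' : PBond P j) :
    ⟪EuclideanSpace.single b (1 : ℝ), (tsV1 hc Λ' w).Sb (EuclideanSpace.single b' (1 : ℝ))⟫_ℝ =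
      ∑ i : CIdx j Λ', w i * (Qpp P j Λ' (EuclideanSpace.single b (1 : ℝ)) i * Qpp P j Λ' (EuclideanSpace.single b' (1 : ℝ)) i) +
        ⟪EuclideanSpace.single b (1 : ℝ), (tsV1 hc Λ' w).Δj (EuclideanSpace.single b' (1 : ℝ))⟫_ℝ := by
  rw [TwoScaleData.Sb, LinearMap.add_apply, inner_add_right, ← inner_single_QaQ_single]
  rfl

end Literature.MathematicalPhysics.QuantumFieldTheory.Balaban1983to89.B6QppKernelV1

end
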